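import Literature.Analysis.FluidPDE.IsentropicEulerFiniteSpeedOfPropagation
import Literature.MathematicalPhysics.KineticTheory.HardSphereEuler

/-!
# Cone locality for the athermal `5 × 5` Euler system — weighted-energy tools

Crux `Summit.AtomisticToContinuum.HydrodynamicLimit.Theses.ImplosionDichotomy.DenseExcursion`
(stmt-AtomisticToContinuum-12586), line `kidder-knob-melnikov`, stub `stub_coneLocality : HsEulerConeLocality`
(the `5 × 5` analogue of `Literature.Analysis.FluidPDE.IsentropicEuler.eqOn_cone_of_eqOn_ball`). This file holds the
two SYSTEM-INDEPENDENT halves of Dafermos's energy method (Hyperbolic Conservation Laws in Continuum Physics, 2nd ed.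
2005, proof of Thm 5.2.1) that the isentropic file proves only for its particular energy density:

* spatial integration by parts at a fixed time against a compactly supported `C¹` weight `φ` on `ℝ³`, for a GENERIC
  `C¹` density `e` (`integral_transport_gen`: `∫ φ De(a) = −∫ (Dφ(a) + φ div a) e`) and for a generic acoustic
  flux (`integral_flux_gen`: `∫ φ c (s div w + Ds(w)) = −∫ (c s Dφ(w) + φ s Dc(w))`, a re-instantiation of
  `IsentropicEuler.integral_flux`);
* the weighted energy in time with an ABSTRACT nonnegative density `D(t, y)` (`eq_zero_of_weightedEnergy`): if `D` is
  continuous on `[0, τ] × ℝ³`, vanishes at `t = 0` and off a ball, has a bounded time derivative `F'` on `(0, τ]`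
  whose slices satisfy `∫ F'(t, ·) ≤ M ∫ D(t, ·)`, then `D(τ, ·) = 0` (fundamental theorem of calculus, Fubini,
  Grönwall — verbatim the route of `IsentropicEuler.weightedEnergy_sub_eq` / `eqOn_of_weight`).

No definitions, no named facts; everything here is folklore calculus.
-/

noncomputable section

open Set Filter MeasureTheory Metric
open scoped Topology ContDiff RealInnerProductSpace

namespace Summit.AtomisticToContinuum.HydrodynamicLimit.Theorems.KidderKnobMelnikov

namespace ConeLocality

open Literature.Analysis.FluidPDE.IsentropicEuler
open Literature.MathematicalPhysics.KineticTheory (V3)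

/-! ### Spatial integration by parts at a fixed time -/

/-- **Integration by parts of a transport term, generic density.** For `φ ∈ C¹(ℝ³)` vanishing for
`‖y − x₀‖ > R`, a `C¹` vector field `a` and a `C¹` scalar `e`,
`∫ φ De(a) = −∫ (Dφ(a) + φ div a) e` (`div a = ∑ᵢ (∂ᵢa)ᵢ`). [folklore; Dafermos 2005, proof of Thm 5.2.1, (5.2.7)] -/
theorem integral_transport_gen {φ e : V3 → ℝ} {a : V3 → V3} {x₀ : V3} {R : ℝ}
    (hφ : ContDiff ℝ 1 φ) (hφ0 : ∀ y, R < ‖y - x₀‖ → φ y = 0) (ha : ContDiff ℝ 1 a)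
    (he : ContDiff ℝ 1 e) :
    ∫ y, φ y * fderiv ℝ e y (a y) =
      -∫ y, (fderiv ℝ φ y (a y) + φ y * ∑ i, fderiv ℝ a y (EuclideanSpace.single i 1) i) * e y := by
  have hed : Differentiable ℝ e := he.differentiable one_ne_zero
  have hφd : Differentiable ℝ φ := hφ.differentiable one_ne_zero
  have had : Differentiable ℝ a := ha.differentiable one_ne_zero
  -- the coordinate functions `φ aⱼ`
  have hf1 : ∀ j, ContDiff ℝ 1 fun y => φ y * a y j := fun j =>
    hφ.mul (contDiff_euclidean.1 ha j)
  have hproj : ∀ j y, HasFDerivAt (fun y => a y j)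
      (PiLp.proj 2 (fun _ : Fin 3 => ℝ) j ∘L fderiv ℝ a y) y := fun j y => by
    have h := (had y).hasFDerivAt
    rw [← hasFDerivWithinAt_univ, hasFDerivWithinAt_euclidean] at h
    exact hasFDerivWithinAt_univ.1 (h j)
  have hfd : ∀ j y, HasFDerivAt (fun y => φ y * a y j)
      (φ y • (PiLp.proj 2 (fun _ : Fin 3 => ℝ) j ∘L fderiv ℝ a y) + a y j • fderiv ℝ φ y) y :=
    fun j y => (hφd y).hasFDerivAt.mul (hproj j y)
  have hf0 : ∀ j y, R < ‖y - x₀‖ → φ y * a y j = 0 := fun j y hy => by rw [hφ0 y hy, zero_mul]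
  -- continuity facts
  have hec : Continuous e := he.continuous
  have hfec : Continuous fun y => fderiv ℝ e y := he.continuous_fderiv one_ne_zero
  have hK : ∀ y, y ∉ closedBall x₀ R → R < ‖y - x₀‖ := fun y hy => by
    rwa [mem_closedBall, dist_eq_norm, not_le] at hy
  -- integration by parts, coordinate by coordinate
  have hibp : ∀ j, ∫ y, (φ y * a y j) * fderiv ℝ e y (EuclideanSpace.single j 1) =
      -∫ y, fderiv ℝ (fun y => φ y * a y j) y (EuclideanSpace.single j 1) * e y := fun j =>
    integral_mul_fderiv_eq_neg (isCompact_closedBall x₀ R) (fun y hy => hf0 j y (hK y hy))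
      (fun y hy => fderiv_eq_zero_of_far (hf0 j) (hK y hy)) ((hf1 j).differentiable one_ne_zero) hed
      ((((hf1 j).continuous_fderiv one_ne_zero).clm_apply continuous_const).mul hec)
      ((hf1 j).continuous.mul (hfec.clm_apply continuous_const))
      ((hf1 j).continuous.mul hec)
  -- pointwise: the integrand on the left is `∑ⱼ (φ aⱼ) ∂ⱼe`
  have hL : ∀ y, φ y * fderiv ℝ e y (a y) =
      ∑ j, (φ y * a y j) * fderiv ℝ e y (EuclideanSpace.single j 1) := by
    intro y
    rw [clm_apply_eq_sum (fderiv ℝ e y) (a y), Finset.mul_sum]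
    refine Finset.sum_congr rfl fun j _ => ?_
    rw [smul_eq_mul]; ring
  -- pointwise: `∑ⱼ ∂ⱼ(φ aⱼ) = Dφ(a) + φ div a`
  have hR : ∀ y, (fderiv ℝ φ y (a y) + φ y * ∑ i, fderiv ℝ a y (EuclideanSpace.single i 1) i) * e y =
      ∑ j, fderiv ℝ (fun y => φ y * a y j) y (EuclideanSpace.single j 1) * e y := by
    intro y
    rw [← Finset.sum_mul]
    congr 1
    rw [clm_apply_eq_sum (fderiv ℝ φ y) (a y), Finset.mul_sum, ← Finset.sum_add_distrib]
    refine Finset.sum_congr rfl fun j _ => ?_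
    rw [(hfd j y).fderiv]
    simp only [add_apply, smul_apply,
      ContinuousLinearMap.coe_comp, Function.comp_apply, PiLp.proj_apply, smul_eq_mul]
    ring
  -- integrability
  have hi1 : ∀ j, Integrable fun y => (φ y * a y j) * fderiv ℝ e y (EuclideanSpace.single j 1) :=
    fun j => integrable_of_far ((hf1 j).continuous.mul (hfec.clm_apply continuous_const))
      fun y hy => by rw [hf0 j y hy, zero_mul]
  have hi2 : ∀ j, Integrable fun y =>
      fderiv ℝ (fun y => φ y * a y j) y (EuclideanSpace.single j 1) * e y :=
    fun j => integrable_of_far ((((hf1 j).continuous_fderiv one_ne_zero).clm_apply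
      continuous_const).mul hec) fun y hy => by rw [fderiv_eq_zero_of_far (hf0 j) hy]; simp
  calc ∫ y, φ y * fderiv ℝ e y (a y)
        = ∫ y, ∑ j, (φ y * a y j) * fderiv ℝ e y (EuclideanSpace.single j 1) :=
          integral_congr_ae (Filter.Eventually.of_forall hL)
    _ = ∑ j, ∫ y, (φ y * a y j) * fderiv ℝ e y (EuclideanSpace.single j 1) :=
          integral_finsetSum _ fun j _ => hi1 j
    _ = ∑ j, -∫ y, fderiv ℝ (fun y => φ y * a y j) y (EuclideanSpace.single j 1) * e y :=
          Finset.sum_congr rfl fun j _ => hibp j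
    _ = -∫ y, ∑ j, fderiv ℝ (fun y => φ y * a y j) y (EuclideanSpace.single j 1) * e y := by
          rw [Finset.sum_neg_distrib, integral_finsetSum _ fun j _ => hi2 j]
    _ = _ := by rw [integral_congr_ae (Filter.Eventually.of_forall hR)]

/-- **Integration by parts of an acoustic flux term, generic coefficient.** For `φ ∈ C¹(ℝ³)` vanishing for
`‖y − x₀‖ > R` and `C¹` scalars `c, s` and vector field `w`,
`∫ φ c (s div w + Ds(w)) = −∫ (c s Dφ(w) + φ s Dc(w))` — `IsentropicEuler.integral_flux` with
`b₁ = c`, `b₂ = c − s`, `a₁ = w`, `a₂ = 0`. [folklore; Dafermos 2005, proof of Thm 5.2.1, (5.2.7)] -/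
theorem integral_flux_gen {φ c s : V3 → ℝ} {w : V3 → V3} {x₀ : V3} {R : ℝ}
    (hφ : ContDiff ℝ 1 φ) (hφ0 : ∀ y, R < ‖y - x₀‖ → φ y = 0) (hc : ContDiff ℝ 1 c)
    (hs : ContDiff ℝ 1 s) (hw : ContDiff ℝ 1 w) :
    ∫ y, φ y * c y * (s y * ∑ i, fderiv ℝ w y (EuclideanSpace.single i 1) i + fderiv ℝ s y (w y)) =
      -∫ y, (c y * s y * fderiv ℝ φ y (w y) + φ y * s y * fderiv ℝ c y (w y)) := by
  have h := integral_flux (ι := Fin 3) (a₁ := w) (a₂ := fun _ => (0 : V3)) (b₁ := c)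
    (b₂ := fun y => c y - s y) hφ hφ0 hw contDiff_const hc (hc.sub hs)
  have hcd : Differentiable ℝ c := hc.differentiable one_ne_zero
  have hsd : Differentiable ℝ s := hs.differentiable one_ne_zero
  have h1 : (fderiv ℝ fun y => c y - s y) = fun y => fderiv ℝ c y - fderiv ℝ s y :=
    funext fun y => fderiv_sub (hcd y) (hsd y)
  have h2 : (fderiv ℝ fun _ : V3 => (0 : V3)) = fun _ => 0 := funext fun y => by simp
  simp only [h1, h2, sub_zero, sub_sub_cancel] at h
  exact h

/-! ### The weighted energy in time: an abstract Grönwall lemma -/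

/-- **The weighted-energy Grönwall lemma (abstract density).** Let `D(t, y) ≥ 0` be continuous on
`[0, τ] × ℝ³` (`τ > 0`), vanish at `t = 0` and for `‖y − x₀‖ > R`, and have, for `0 < t ≤ τ`, a time
derivative `F'(t, y)` which is continuous on `(0, τ] × ℝ³`, bounded, zero for `‖y − x₀‖ > R`, and whose
slices satisfy `∫ F'(t, ·) ≤ M ∫ D(t, ·)`. Then `D(τ, ·) = 0`: with `E(t) = ∫ D(t, ·)`, the fundamental
theorem of calculus and Fubini give `E(t) = ∫₀ᵗ ∫ F' ≤ M ∫₀ᵗ E`, Grönwall gives `E ≡ 0`, and a continuous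
nonnegative function with zero integral vanishes. [cite: Dafermos2005, §5.2, proof of Thm 5.2.1, (5.2.13)–(5.2.14)] -/
theorem eq_zero_of_weightedEnergy : ∀ {τ R C M : ℝ} {x₀ : V3} {D F' : ℝ → V3 → ℝ}, 0 < τ →
    ContinuousOn (fun p : ℝ × V3 => D p.1 p.2) (Icc 0 τ ×ˢ univ) →
    ContinuousOn (fun p : ℝ × V3 => F' p.1 p.2) (Ioc 0 τ ×ˢ univ) →
    (∀ t ∈ Ioc 0 τ, ∀ y, HasDerivAt (fun s => D s y) (F' t y) t) →
    (∀ t ∈ Ioc 0 τ, ∀ y, |F' t y| ≤ C) →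
    (∀ t ∈ Icc 0 τ, ∀ y, R < ‖y - x₀‖ → D t y = 0) →
    (∀ t ∈ Ioc 0 τ, ∀ y, R < ‖y - x₀‖ → F' t y = 0) →
    (∀ y, D 0 y = 0) → (∀ t ∈ Icc 0 τ, ∀ y, 0 ≤ D t y) →
    (∀ t ∈ Ioc 0 τ, ∫ y, F' t y ≤ M * ∫ y, D t y) →
    ∀ y, D τ y = 0 := by
  intro τ R C M x₀ D F' hτ hDc hF'c hderiv hF'b hDfar hF'far hD0 hDnn hslice
  have hK : IsCompact (Icc 0 τ ×ˢ closedBall x₀ R) := isCompact_Icc.prod (isCompact_closedBall x₀ R)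
  -- ### the weighted energy `E` is continuous on `[0, τ]`
  set E : ℝ → ℝ := fun s => ∫ y, D s y with hE
  obtain ⟨CD, hCD⟩ := hK.exists_bound_of_continuousOn (hDc.mono (prod_mono le_rfl (subset_univ _)))
  have hEc : ContinuousOn E (Icc 0 τ) := by
    refine continuousOn_of_dominated (bound := (closedBall x₀ R).indicator fun _ => CD) ?_ ?_ ?_ ?_
    · intro t ht
      exact (hDc.comp_continuous (continuous_const.prodMk continuous_id)
        fun y => ⟨ht, mem_univ _⟩).aestronglyMeasurable
    · intro t ht
      refine Filter.Eventually.of_forall fun y => ?_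
      by_cases hy : y ∈ closedBall x₀ R
      · rw [indicator_of_mem hy]
        exact hCD (t, y) ⟨ht, hy⟩
      · rw [indicator_of_notMem hy]
        rw [mem_closedBall, dist_eq_norm, not_le] at hy
        rw [hDfar t ht y hy, norm_zero]
    · exact (integrableOn_const (hs := measure_closedBall_lt_top.ne)).integrable_indicator
        measurableSet_closedBall
    · refine Filter.Eventually.of_forall fun y => ?_
      exact hDc.comp (continuous_id.prodMk continuous_const).continuousOn
        fun t ht => ⟨ht, mem_univ _⟩
  have hEnn : ∀ s ∈ Icc 0 τ, 0 ≤ E s := fun s hs => integral_nonneg fun y => hDnn s hs y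
  have hE0 : E 0 = 0 := by simp only [hE, hD0, integral_zero]
  -- ### the energy identity `E(τ') − E(0) = ∫₀^{τ'} ∫ F'`
  have hident : ∀ τ' ∈ Icc 0 τ, E τ' - E 0 = ∫ t in Ioc 0 τ', ∫ y, F' t y ∧
      IntegrableOn (fun t => ∫ y, F' t y) (Ioc 0 τ') := by
    intro τ' hτ'
    -- the fundamental theorem of calculus, pointwise in `y`
    have hFTC : ∀ y, ∫ t in (0 : ℝ)..τ', F' t y = D τ' y - D 0 y := by
      intro y
      apply intervalIntegral.integral_eq_sub_of_hasDerivAt_of_le hτ'.1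
      · exact hDc.comp (continuous_id.prodMk continuous_const).continuousOn
          fun t ht => ⟨⟨ht.1, ht.2.trans hτ'.2⟩, mem_univ _⟩
      · intro t ht
        exact hderiv t ⟨ht.1, ht.2.le.trans hτ'.2⟩ y
      · rw [intervalIntegrable_iff_integrableOn_Ioc_of_le hτ'.1]
        refine IntegrableOn.of_bound measure_Ioc_lt_top ?_ C ?_
        · refine ContinuousOn.aestronglyMeasurable ?_ measurableSet_Ioc
          exact hF'c.comp (continuous_id.prodMk continuous_const).continuousOn
            fun t ht => ⟨⟨ht.1, ht.2.trans hτ'.2⟩, mem_univ _⟩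
        · exact ae_restrict_of_forall_mem measurableSet_Ioc fun t ht => by
            rw [Real.norm_eq_abs]
            exact hF'b t ⟨ht.1, ht.2.trans hτ'.2⟩ y
    -- integrability on the product `(0, τ'] × ℝ³`
    have hprod : IntegrableOn (fun p : ℝ × V3 => F' p.1 p.2) (Ioc 0 τ' ×ˢ univ) volume := by
      have h1 : IntegrableOn (fun p : ℝ × V3 => F' p.1 p.2) (Ioc 0 τ' ×ˢ closedBall x₀ R) volume := by
        refine IntegrableOn.of_bound ?_ ?_ C ?_
        · calc volume (Ioc 0 τ' ×ˢ closedBall x₀ R)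
              ≤ volume (Icc 0 τ ×ˢ closedBall x₀ R) :=
                measure_mono (prod_mono (Ioc_subset_Icc_self.trans (Icc_subset_Icc_right hτ'.2)) le_rfl)
            _ < ⊤ := hK.measure_lt_top
        · refine ContinuousOn.aestronglyMeasurable ?_ (measurableSet_Ioc.prod measurableSet_closedBall)
          exact hF'c.mono (prod_mono (fun t ht => ⟨ht.1, ht.2.trans hτ'.2⟩) (subset_univ _))
        · exact ae_restrict_of_forall_mem (measurableSet_Ioc.prod measurableSet_closedBall)
            fun p hp => by
              rw [Real.norm_eq_abs]
              exact hF'b p.1 ⟨hp.1.1, hp.1.2.trans hτ'.2⟩ p.2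
      refine h1.of_forall_sdiff_eq_zero (measurableSet_Ioc.prod MeasurableSet.univ) fun p hp => ?_
      have hp1 : p.1 ∈ Ioc 0 τ' := hp.1.1
      have hp2 : p.2 ∉ closedBall x₀ R := fun h => hp.2 ⟨hp1, h⟩
      rw [mem_closedBall, dist_eq_norm, not_le] at hp2
      exact hF'far p.1 ⟨hp1.1, hp1.2.trans hτ'.2⟩ p.2 hp2
    have hprod' : Integrable (Function.uncurry fun t y => F' t y)
        ((volume.restrict (Ioc 0 τ')).prod (volume : Measure V3)) := by
      rw [← Measure.restrict_univ (μ := (volume : Measure V3)), Measure.prod_restrict,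
        ← Measure.volume_eq_prod]
      exact hprod
    refine ⟨?_, hprod'.integral_prod_left⟩
    have hEτ : Integrable fun y => D τ' y :=
      integrable_of_far (hDc.comp_continuous (continuous_const.prodMk continuous_id)
        fun y => ⟨hτ', mem_univ _⟩) fun y hy => hDfar τ' hτ' y hy
    have hE0i : Integrable fun y => D 0 y :=
      integrable_of_far (hDc.comp_continuous (continuous_const.prodMk continuous_id)
        fun y => ⟨⟨le_rfl, hτ.le⟩, mem_univ _⟩) fun y hy => hDfar 0 ⟨le_rfl, hτ.le⟩ y hy
    calc E τ' - E 0 = ∫ y, (D τ' y - D 0 y) := (integral_sub hEτ hE0i).symm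
      _ = ∫ y, ∫ t in Ioc 0 τ', F' t y := integral_congr_ae (Filter.Eventually.of_forall fun y => by
          simp only
          rw [← hFTC y, intervalIntegral.integral_of_le hτ'.1])
      _ = ∫ t in Ioc 0 τ', ∫ y, F' t y := (integral_integral_swap hprod').symm
  -- ### `E(τ') ≤ M ∫₀^{τ'} E` for `0 ≤ τ' ≤ τ`
  have hineq : ∀ τ' ∈ Icc 0 τ, E τ' ≤ M * ∫ s in (0 : ℝ)..τ', E s := by
    intro τ' hτ'
    obtain ⟨hid, hint⟩ := hident τ' hτ'
    have hEI : IntegrableOn (fun s => M * E s) (Ioc 0 τ') :=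
      ((hEc.mono (Icc_subset_Icc_right hτ'.2)).integrableOn_Icc.mono_set Ioc_subset_Icc_self).const_mul M
    have hmono : ∫ s in Ioc 0 τ', (∫ y, F' s y) ≤ ∫ s in Ioc 0 τ', M * E s :=
      setIntegral_mono_on hint hEI measurableSet_Ioc fun s hs => hslice s ⟨hs.1, hs.2.trans hτ'.2⟩
    rw [intervalIntegral.integral_of_le hτ'.1, ← integral_const_mul]
    have h : E τ' - E 0 = ∫ s in Ioc 0 τ', ∫ y, F' s y := hid
    rw [hE0, sub_zero] at h
    calc E τ' = ∫ s in Ioc 0 τ', ∫ y, F' s y := h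
      _ ≤ _ := hmono
  -- ### Grönwall: `E ≡ 0` on `[0, τ]`
  have hEr : Continuous ((Icc 0 τ).restrict E) := continuousOn_iff_continuous_restrict.1 hEc
  set Et : ℝ → ℝ := Set.IccExtend hτ.le ((Icc 0 τ).restrict E) with hEt
  have hEtc : Continuous Et := hEr.Icc_extend'
  have hEteq : ∀ s ∈ Icc 0 τ, Et s = E s := fun s hs => by
    rw [hEt, Set.IccExtend_of_mem _ _ hs]; rfl
  set G : ℝ → ℝ := fun r => ∫ s in (0 : ℝ)..r, Et s with hG
  have hGderiv : ∀ r, HasDerivAt G (Et r) r := fun r =>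
    intervalIntegral.integral_hasDerivAt_right (hEtc.intervalIntegrable _ _)
      (hEtc.stronglyMeasurableAtFilter _ _) hEtc.continuousAt
  have hGc : Continuous G := continuous_iff_continuousAt.mpr fun r => (hGderiv r).continuousAt
  have hGE : ∀ r ∈ Icc 0 τ, G r = ∫ s in (0 : ℝ)..r, E s := fun r hr =>
    intervalIntegral.integral_congr fun s hs => hEteq s (by
      rw [uIcc_of_le hr.1] at hs; exact ⟨hs.1, hs.2.trans hr.2⟩)
  have hGnn : ∀ r ∈ Icc 0 τ, 0 ≤ G r := fun r hr => by
    rw [hGE r hr]; exact intervalIntegral.integral_nonneg hr.1 fun s hs => hEnn s ⟨hs.1, hs.2.trans hr.2⟩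
  have hG0 : ∀ r ∈ Icc 0 τ, G r = 0 :=
    eq_zero_of_abs_deriv_le_mul_abs_self_of_eq_zero_right (K := M) hGc.continuousOn
      (fun r _ => (hGderiv r).hasDerivWithinAt) (by simp [hG]) fun r hr => by
        have hrI : r ∈ Icc 0 τ := ⟨hr.1, hr.2.le⟩
        rw [hEteq r hrI, Real.norm_of_nonneg (hEnn r hrI), Real.norm_of_nonneg (hGnn r hrI), hGE r hrI]
        exact hineq r hrI
  have hEτ : E τ = 0 := by
    have h1 := hineq τ ⟨hτ.le, le_rfl⟩
    rw [← hGE τ ⟨hτ.le, le_rfl⟩, hG0 τ ⟨hτ.le, le_rfl⟩, mul_zero] at h1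
    exact le_antisymm h1 (hEnn τ ⟨hτ.le, le_rfl⟩)
  -- ### conclusion: the (continuous, nonnegative) integrand vanishes identically at time `τ`
  have hslc : Continuous fun y => D τ y :=
    hDc.comp_continuous (continuous_const.prodMk continuous_id) fun y => ⟨⟨hτ.le, le_rfl⟩, mem_univ _⟩
  have hsli : Integrable fun y => D τ y :=
    integrable_of_far hslc fun y hy => hDfar τ ⟨hτ.le, le_rfl⟩ y hy
  have hnn : 0 ≤ fun y => D τ y := fun y => hDnn τ ⟨hτ.le, le_rfl⟩ y
  have hae := (integral_eq_zero_iff_of_nonneg hnn hsli).1 hEτ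
  have hzero : (fun y => D τ y) = fun _ => 0 := (hslc.ae_eq_iff_eq volume continuous_const).1 hae
  exact fun y => congr_fun hzero y

end ConeLocality

end Summit.AtomisticToContinuum.HydrodynamicLimit.Theorems.KidderKnobMelnikov

end
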